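import Literature.MathematicalPhysics.QuantumFieldTheory.Balaban1983to89.Node00.BgHierFrameOfRecord
import Literature.MathematicalPhysics.QuantumFieldTheory.Balaban1983to89.B15AveragingHolomorphicLocal
import Literature.MathematicalPhysics.QuantumFieldTheory.Balaban1983to89.B12B0LoopGeometry267
import Summits.QuantumFields.YangMills.Theorems.BalabanUVNodesC44IterMhLocalityPr
import HarnessLib

/-!
# [B7] (82)–(87): THE RECORD'S HIERARCHICAL FRAME `R^{(k)}(V)(y)` READS `V` ON THE BLOCK `B^k(y)` ONLY — (T3)∕(T4) OF THE (ρ-frame-min) EDITION DISCHARGED FOR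
# node00-def-Y's INHABITANT `hierFrameDatumOfRecord` ((A1) ✓`Node00.BgHierFrameOfRecord`)

Cell `pub-ymgap` ∕ `ym-nodeO-ideate`, porter lineage `ymgap-nodeO-port-PTB-1` (gen 10); director-ym g24 №621 (junction pin, first brick); `--kind proof --supports
stmt-QuantumFields-27238 --as helper`; count-neutral; NEW basename.  [B7] = [Balaban1985Averaging]; [I] = [Balaban1987RG1].

WHAT THIS FILE DOES.  PT-B's framed doors (✓`…C44IterMhConePr`, ✓`…C44IterMhLocalityPr`, ✓`…Prop4*Pr`, hand-KLC ✓`…KLCPrOfB7Prop5` §5) DISPLAY two block-locality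
hypotheses on the frame datum `𝔥 : FrameDatum (F.P K) N k U₀`: for a fine region `Y` SATURATED below `k`,
(hmap) «`V = V′` on `bondsIn 0 Y` ⇒ `h(V)(y) = h(V′)(y)` and `h⁻¹(V)(y) = h⁻¹(V′)(y)` whenever `toFine k y ∈ Y`», (hderiv) the same for `Dh(↑U₀)[Z](y)`.
Here both are PROVED for the record's inhabitant `hierFrameDatumOfRecord F N k U₀` (def-Y (A1)), unconditionally (on the guard the datum is print's hierarchical
frame pair, off the guard it is the frameless datum, for which both rows are trivial):
* §1 (generic, any averaging family `av`) `ctrHolM_congr₁` — the centre-contour transporter `Z(Γ_{y,x_r})` reads the level-`j` field only on bonds with BOTH ends in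
  `B(y)` (lit ✓`B12B0LoopGeometry267.stair_src_tgt_blockOf`: staircases stay inside their block, + lit ✓`holMh_congr`); `frameArg_congr`, `frameExpo_congr`,
  ★★ `framePair_apply_congr_of_eqOn_bondsIn` — by induction on the level, `(Φ_k, Ψ_k)(V)(y) = (Φ_k, Ψ_k)(V′)(y)` for `toFine k y ∈ Y` when `V = V′` on `bondsIn 0 Y`
  (the un-framed iterate inside the arguments of the logarithms by lit ✓`iterMh_apply_congr_of_eqOn_bondsIn`).
* §2 (record) ★★ `hierFrameDatumOfRecord_map_inv_congr_of_eqOn_bondsIn` = (hmap) VERBATIM at `𝔥 := hierFrameDatumOfRecord F N k U₀`;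
  ★ `hierFrameDatumOfRecord_deriv_congr_of_eqOn_bondsIn` = (hderiv) VERBATIM (from (hmap) by ✓`FrameDatum.deriv_apply_congr_of_map_congr`).

HONEST FRAMING.  Lattice bookkeeping over landed letters ([I] (0.3)∕(0.4) locators; [B7] (82)–(87) is where print states that `R^{(j)}_{0,y}` depends on `V|B^j(y)`); NO estimate
((81), (101)–(112) untouched: the window∕near-one debts (T1)∕(T2) of the doors stay DISPLAYED); nothing of [B7] Prop. 5 ∕ [B11] Prop. 4 proved; K0ᴬ ⟨stmt-QuantumFields-27238⟩
NOT closed; NODE O 0∕1; COUNT 8∕28 · K 1∕4 UNMOVED; finite `𝕋⁴_{L^K}` at fixed ε — NOT continuum ∕ OS ∕ Clay; **the Yang–Mills mass gap (Clay) is NOT proved by any of this.**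
No `sorry`, `instance`, `notation`, `set_option`; standard axioms.
-/

noncomputable section

open scoped Matrix Matrix.Norms.L2Operator Topology

namespace Summit.QuantumFields.YangMills.Theorems.C44IterMh

open Literature.MathematicalPhysics.QuantumFieldTheory.Balaban1983to89
open Literature.MathematicalPhysics.QuantumFieldTheory.Balaban1983to89.Node00
open T4Continuum BlockAveraging
open B15AveragingHolomorphic (iterMh holMh)
open B15AveragingHolomorphicLocal (holMh_congr iterMh_apply_congr_of_eqOn_bondsIn)
open B12B0LoopGeometry267 (stair_src_tgt_blockOf)
open B10Eq42TorusConstraint (bondsIn mem_bondsIn_iff)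
open B10Eq38TorusDomains (toFine)
open MatrixLog (mlog)
open NormedSpace (exp)

/-! ## §1  The hierarchical frame pair reads the field on the block only (generic averaging family) -/

section Generic

variable {P : Params} {N : ℕ} [NeZero N] {j : ℕ}

omit [NeZero N] in
/-- **THE CENTRE-CONTOUR TRANSPORTER IS ONE-BLOCK LOCAL**: `Z(Γ_{y,x_r})` reads the level-`j` matrix field `Z` only on bonds with both ends in `B(y)` (every bond of the
staircase `Γ_{y,x_r}` from the centre of `B(y)` has both ends in `B(y)`). [cite: Balaban1987RG1, (0.3) p.252; Balaban1985Averaging, (42) p.23, (78) p.30] -/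
theorem ctrHolM_congr₁ (hj : j + 1 ≤ P.m + P.K) {Z Z' : PBond P j → Matrix (Fin N) (Fin N) ℂ} (y : Site P (j + 1)) (r : Fin P.d → Fin P.L)
    (hZZ' : ∀ b : PBond P j, blockOf b.src = y → blockOf b.tgt = y → Z b = Z' b) : ctrHolM Z y r = ctrHolM Z' y r := by
  unfold ctrHolM ctrWord
  exact holMh_congr fun s hs => by
    obtain ⟨h₁, h₂⟩ := stair_src_tgt_blockOf hj y (Equiv.refl _) r s hs
    exact hZZ' _ h₁ h₂

omit [NeZero N] in
/-- On a fine region `Y` saturated at level `j+1`, two level-`j` fields agreeing on `bondsIn j Y` have the same centre-contour transporters at every `y` with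
`toFine (j+1) y ∈ Y`. [cite: Balaban1987RG1, (0.3) p.252 (bookkeeping)] -/
theorem ctrHolM_congr_of_eqOn_bondsIn (hj : j + 1 ≤ P.m + P.K) {Y : Set (Site P 0)}
    (hY : ∀ s : Site P j, toFine j s ∈ Y ↔ toFine (j + 1) (blockOf s) ∈ Y)
    {Z Z' : PBond P j → Matrix (Fin N) (Fin N) ℂ} (hZZ' : ∀ b : PBond P j, b ∈ bondsIn j Y → Z b = Z' b)
    {y : Site P (j + 1)} (hy : toFine (j + 1) y ∈ Y) (r : Fin P.d → Fin P.L) : ctrHolM Z y r = ctrHolM Z' y r := by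
  refine ctrHolM_congr₁ hj y r fun b h₁ h₂ => hZZ' b (mem_bondsIn_iff.2 ⟨(hY _).2 ?_, (hY _).2 ?_⟩)
  · rwa [h₁]
  · exact (show blockOf b.tgt = y from h₂) ▸ hy

/-- The argument of the logarithm in (85) at `(y, r)` depends on the pair `Θ` only at `emb y` and at `x_r`, and on `Z` only through `Z(Γ_{y,x_r})`.
[cite: Balaban1985Averaging, (78)–(79) p.30, (85) p.30 (bookkeeping)] -/
theorem frameArg_congr {Z Z' : PBond P j → Matrix (Fin N) (Fin N) ℂ} (W : GaugeField P j (SU N))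
    {Θ Θ' : Site P j → Matrix (Fin N) (Fin N) ℂ × Matrix (Fin N) (Fin N) ℂ} {y : Site P (j + 1)} {r : Fin P.d → Fin P.L}
    (hZ : ctrHolM Z y r = ctrHolM Z' y r) (he : Θ (emb y) = Θ' (emb y)) (hx : Θ (Site.blockSite y r) = Θ' (Site.blockSite y r)) :
    frameArg Z W Θ y r = frameArg Z' W Θ' y r := by
  unfold frameArg
  rw [hZ, he, hx]
set_option maxHeartbeats 400000 in
/-- The exponent of (85) at `y` depends on `Θ` only on `{emb y} ∪ B(y)` and on `Z` only through the transporters `Z(Γ_{y,x})`, `x ∈ B(y)`.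
[cite: Balaban1985Averaging, (79) p.30, (85) p.30 (bookkeeping)] -/
theorem frameExpo_congr {Z Z' : PBond P j → Matrix (Fin N) (Fin N) ℂ} (W : GaugeField P j (SU N))
    {Θ Θ' : Site P j → Matrix (Fin N) (Fin N) ℂ × Matrix (Fin N) (Fin N) ℂ} {y : Site P (j + 1)}
    (hZ : ∀ r : Fin P.d → Fin P.L, ctrHolM Z y r = ctrHolM Z' y r) (he : Θ (emb y) = Θ' (emb y))
    (hx : ∀ r : Fin P.d → Fin P.L, Θ (Site.blockSite y r) = Θ' (Site.blockSite y r)) :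
    frameExpo Z W Θ y = frameExpo Z' W Θ' y := by
  unfold frameExpo
  congr 1
  exact Finset.sum_congr rfl fun r _ => by rw [frameArg_congr W (hZ r) he (hx r)]

/-- ★★ **THE HIERARCHICAL FRAME PAIR `(Φ_k, Ψ_k)(V)(y)` READS `V` ON THE BLOCK `B^k(y)` ONLY**: for a fine region `Y` saturated at every level `< k`, two complexified fine
fields agreeing on `bondsIn 0 Y` have the same frame pair at every `k`-site `y` with `toFine k y ∈ Y` (induction on the recursion (84)–(87): the pair at `emb y` and at the
block sites `x ∈ B(y)`, the un-framed iterate along the centre contours inside `B(y)` by lit ✓`iterMh_apply_congr_of_eqOn_bondsIn`, the background factor unchanged).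
[cite: Balaban1985Averaging, (82)–(88) pp.30–31; Balaban1987RG1, (0.3)–(0.4) pp.252–253] -/
theorem framePair_apply_congr_of_eqOn_bondsIn (av : ∀ j, Averaging P j (SU N)) (U₀ : GaugeField P 0 (SU N)) {Y : Set (Site P 0)} :
    ∀ (k : ℕ), k ≤ P.m + P.K → (∀ j, j < k → ∀ s : Site P j, toFine j s ∈ Y ↔ toFine (j + 1) (blockOf s) ∈ Y) →
      ∀ {V V' : PBond P 0 → Matrix (Fin N) (Fin N) ℂ}, (∀ b : PBond P 0, b ∈ bondsIn 0 Y → V b = V' b) →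
        ∀ y : Site P k, toFine k y ∈ Y → framePair av U₀ V k y = framePair av U₀ V' k y
  | 0, _, _, _, _, _, y, _ => by rw [framePair_zero, framePair_zero]
  | k + 1, hk, hY, V, V', hVV', y, hy => by
    have hYk := hY k (Nat.lt_succ_self k)
    have ih : ∀ x : Site P k, toFine k x ∈ Y → framePair av U₀ V k x = framePair av U₀ V' k x :=
      framePair_apply_congr_of_eqOn_bondsIn av U₀ k (Nat.le_of_succ_le hk) (fun j hj => hY j (Nat.lt_succ_of_lt hj)) hVV'
    have he : framePair av U₀ V k (emb y) = framePair av U₀ V' k (emb y) :=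
      ih _ ((hYk _).2 (by rwa [Site.blockOf_emb hk]))
    have hx : ∀ r : Fin P.d → Fin P.L, framePair av U₀ V k (Site.blockSite y r) = framePair av U₀ V' k (Site.blockSite y r) := fun r =>
      ih _ ((hYk _).2 (by rwa [Site.blockOf_blockSite hk]))
    have hZ : ∀ r : Fin P.d → Fin P.L, ctrHolM (iterMh k V) y r = ctrHolM (iterMh k V') y r := fun r =>
      ctrHolM_congr_of_eqOn_bondsIn hk hYk
        (fun b hb => iterMh_apply_congr_of_eqOn_bondsIn k (Nat.le_of_succ_le hk) (fun j hj => hY j (Nat.lt_succ_of_lt hj)) hVV' b hb) hy r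
    have hE : frameExpo (iterMh k V) (Averaging.iter av k U₀) (framePair av U₀ V k) y =
        frameExpo (iterMh k V') (Averaging.iter av k U₀) (framePair av U₀ V' k) y := frameExpo_congr _ hZ he hx
    rw [framePair_succ, framePair_succ]
    simp only [frameStep, hE, he]

end Generic

/-! ## §2  (hmap) and (hderiv) for the record's inhabitant `hierFrameDatumOfRecord F N k U₀` -/

section Record

variable (F : T4Family) (N : ℕ) [NeZero N] {K : ℕ} (k : ℕ) (U₀ : GaugeField (F.P K) 0 (SU N))

/-- ★★ **(hmap) FOR THE RECORD'S FRAME DATUM** — the displayed frame block-locality of PT-B's framed doors, DISCHARGED at def-Y's inhabitant: for `Y` saturated below `k` and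
`V = V′` on `bondsIn 0 Y`, `h(V)(y) = h(V′)(y)` and `h⁻¹(V)(y) = h⁻¹(V′)(y)` at every `y` with `toFine k y ∈ Y` (on the guard: §1 for `(Ψ_k, Φ_k)`; off the guard the datum is
frameless, `h = h⁻¹ = 1`). [cite: Balaban1985Averaging, (82)–(87) pp.30–31, (92) p.31] -/
theorem hierFrameDatumOfRecord_map_inv_congr_of_eqOn_bondsIn (hk : k ≤ (F.P K).m + (F.P K).K) :
    ∀ Y : Set (Site (F.P K) 0), (∀ i, i < k → ∀ s : Site (F.P K) i, toFine i s ∈ Y ↔ toFine (i + 1) (blockOf s) ∈ Y) →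
      ∀ V V' : PBond (F.P K) 0 → Matrix (Fin N) (Fin N) ℂ, (∀ b : PBond (F.P K) 0, b ∈ bondsIn 0 Y → V b = V' b) →
      ∀ y : Site (F.P K) k, toFine k y ∈ Y →
        (hierFrameDatumOfRecord F N k U₀).map V y = (hierFrameDatumOfRecord F N k U₀).map V' y ∧
          (hierFrameDatumOfRecord F N k U₀).inv V y = (hierFrameDatumOfRecord F N k U₀).inv V' y := by
  intro Y hY V V' hVV' y hy
  by_cases hU₀ : SmallBelow (avOfRecord F N K) k U₀
  · have h := framePair_apply_congr_of_eqOn_bondsIn (avOfRecord F N K) U₀ k hk hY hVV' y hy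
    rw [hierFrameDatumOfRecord_map F N k U₀ hU₀, hierFrameDatumOfRecord_map F N k U₀ hU₀, hierFrameDatumOfRecord_inv F N k U₀ hU₀,
      hierFrameDatumOfRecord_inv F N k U₀ hU₀]
    exact ⟨by simp only [h], by simp only [h]⟩
  · rw [hierFrameDatumOfRecord_of_not_smallBelow F N k U₀ hU₀]
    exact ⟨rfl, rfl⟩

/-- ★ **(hderiv) FOR THE RECORD'S FRAME DATUM**: the derivative letter `Dh(↑U₀)[Z](y)` reads `Z` only on `bondsIn 0 Y` whenever `toFine k y ∈ Y` (from (hmap) by the generic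
✓`FrameDatum.deriv_apply_congr_of_map_congr`: it is the line derivative of `t ↦ h(↑U₀ + tZ)(y)`). [cite: Balaban1985Averaging, (82)–(87) pp.30–31; Balaban1985BackgroundPropagators, (3.113) p.418] -/
theorem hierFrameDatumOfRecord_deriv_congr_of_eqOn_bondsIn (hk : k ≤ (F.P K).m + (F.P K).K) :
    ∀ Y : Set (Site (F.P K) 0), (∀ i, i < k → ∀ s : Site (F.P K) i, toFine i s ∈ Y ↔ toFine (i + 1) (blockOf s) ∈ Y) →
      ∀ Z Z' : PBond (F.P K) 0 → Matrix (Fin N) (Fin N) ℂ, (∀ b : PBond (F.P K) 0, b ∈ bondsIn 0 Y → Z b = Z' b) →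
      ∀ y : Site (F.P K) k, toFine k y ∈ Y → (hierFrameDatumOfRecord F N k U₀).deriv Z y = (hierFrameDatumOfRecord F N k U₀).deriv Z' y :=
  fun Y hY _ _ hZZ' _ hy =>
    FrameDatum.deriv_apply_congr_of_map_congr (hierFrameDatumOfRecord F N k U₀)
      (fun V V' hVV' y hy => (hierFrameDatumOfRecord_map_inv_congr_of_eqOn_bondsIn F N k U₀ hk Y hY V V' hVV' y hy).1) hZZ' hy

end Record

end Summit.QuantumFields.YangMills.Theorems.C44IterMh

end
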